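import Summits.CriticalPhenomena.PercolationContinuityZ3.Theorems.PercNearOneGluingNoHeavyLowerTailSahiExmaxSstar
import Summits.CriticalPhenomena.PercolationContinuityZ3.Theorems.PercNearOneGluingNoHeavyLowerTailSahiGeometricWeights
import Mathlib
import HarnessLib
import HarnessLib.Audit.Tags

/-!
# `NoHeavyLowerTail` (crux stmt-CriticalPhenomena-4575), master-family line P1 (gen 20):
# S₃^max for the minimal mixed-payer system `S*` at EVERY product measure (kernel)

Support file (seat `prim-masterthm-p1`, gen 20; `--supports stmt-CriticalPhenomena-4575`).  Two lines from the tree: gen 19's `exmax_Sstar`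
(one payer suffices for `S* = BBB1B23A11111AAA` at ALL nonnegative exchangeable weights) and gen 20's geometric-weight dictionary
(`…SahiGeometricWeights`: at the i.i.d. weights `geomWt p` of a product measure, `T = Σ[rainbow]α_iα_jα_l = 6e₃` and `Φ_a = 3·m(a)·(2κo − Σ_{j≠l}α_jα_l) = 6·m(a)·G`).
RESULT (`s3max_Sstar_geom`): for every bias vector `p ∈ [0,1]^ℕ`, in the masses of `S*` under `p`, `6e₃ ≤ 6κG` or `6e₃ ≤ 6oG` — i.e. S₃^max `e₃ ≤ max(κ,o)·G`
holds for `S*` at every product measure.  `S*` is the smallest MIXED system (gen 16: neither payer suffices at every vertex fibre), so this is the first kernel instance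
of S₃^max beyond the vertex-uniform strata; the seat's memo (gen 20 §4) also records the three-line hand identity
`q₂q₃·6(κG−e₃) + p₂p₃·6(oG−e₃) = 6p₀q₀p₁q₁·p₂²q₂·p₃q₃²·[(q₀p₁+p₀q₁)(p₃+q₂)+p₀p₁q₂+q₀q₁p₃]` (a "pair-shift certificate", `D = {2,3}`).
HONEST FRAMING: a corollary of two tree files; S₃^max in general remains OPEN. [this work]
-/

namespace Summit.CriticalPhenomena.PercolationContinuityZ3.Theorems

namespace SahiPivotFamily

open Finset AntipodalStrongHarris AntipodalStrongHarris.Lab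

/-- **S₃^max for `S*` at every product measure (mass form).**  For every bias vector `p` with `0 ≤ p_j ≤ 1`: the rainbow mass
`Σ_{ijl}[rainbow]α_iα_jα_l` (`= 6e₃`) is at most `3κ·(2κo − Σ_{j≠l}α_jα_l)` (`= 6κG`, the core pays) or at most `3o·(…)` (`= 6oG`, the outside pays). [this work] -/
theorem s3max_Sstar_geom (p : ℕ → ℝ) (hp : ∀ j, 0 ≤ p j ∧ p j ≤ 1) :
    (∑ i : Fin 3, ∑ j : Fin 3, ∑ l : Fin 3, (rainbow (petal i : Lab 3) (petal j) (petal l) : ℝ) *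
        (labMass S4 p Sstar (petal i) * labMass S4 p Sstar (petal j) * labMass S4 p Sstar (petal l)) ≤
      3 * labMass S4 p Sstar top *
        (2 * labMass S4 p Sstar top * labMass S4 p Sstar bot -
          ∑ j : Fin 3, ∑ l : Fin 3, if j = l then 0 else labMass S4 p Sstar (petal j) * labMass S4 p Sstar (petal l))) ∨
    (∑ i : Fin 3, ∑ j : Fin 3, ∑ l : Fin 3, (rainbow (petal i : Lab 3) (petal j) (petal l) : ℝ) *
        (labMass S4 p Sstar (petal i) * labMass S4 p Sstar (petal j) * labMass S4 p Sstar (petal l)) ≤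
      3 * labMass S4 p Sstar bot *
        (2 * labMass S4 p Sstar top * labMass S4 p Sstar bot -
          ∑ j : Fin 3, ∑ l : Fin 3, if j = l then 0 else labMass S4 p Sstar (petal j) * labMass S4 p Sstar (petal l))) := by
  rcases exmax_Sstar (geomWt p) (fun j c => geomWt_nonneg p hp j c) with h | h
  · exact Or.inl (onePayer_of_geom S4 p Sstar top h)
  · exact Or.inr (onePayer_of_geom S4 p Sstar bot h)

end SahiPivotFamily

end Summit.CriticalPhenomena.PercolationContinuityZ3.Theorems
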